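import Summits.ABC.IUTFork.Repair.RHHeightClassKLine
import HarnessLib

/-!
# R-H row 8 «heightclass» — the K-LINE TWO-SIDED LAW FOR EVERY k, binders discharged: `λ_k ∈ Σ₈ at l` once `l·ε ≥ 7^{⌈k/2⌉}`, `λ_k ∉ Σ₈ at l` while `l·ε < 6·7^T` with `k ≥ 2T+3`
Companion of `RHHeightClassKLine` (p476616), the tables `RHHeightClassKLineCert*` (k ≤ 40) and `RHHeightClassKLineNonUniform` (p479103); seat abc-iut-rh-typ-8
gen 4; rung LADDER-ABC:A2.RESCUE.H. PROOF-ONLY (0 definitions). abc-iut-rh2-q3-typ-1's slice-currency bounds `RH.Q3LTailBand.hexSlice_of_k_le` (k0_ge) /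
`not_hexSlice_of_k_ge` (k0_le) carry member-valuation binders (`r ≤ 1`, `r ≤ p^t − t·e`, `−T·e ≤ r`); on the K-line (`p = 7 < l` prime, `e = l·ε`) the untied
`r♯` EXISTS (`exists_strictMinPow_kline`) and satisfies all three — the last one whenever `e < 6·7^T` (then `t ↦ 7^t − t·e` increases from `T` on, so the
minimiser is `≤ T` and `r♯ ≥ −T·e`: `strictMinPow_ge_neg_of_lt`). Result, for every k by name: `kline_in_of_pow_le` («IN at every prime l with 7^t ≤ l·ε,
k ≤ 2t» ⟹ l₀⁸(k)·ε(k) ≤ 7^{⌈k/2⌉} up to the next prime) and `kline_out_of_lt` («OUT at every prime l ≥ 11 with l·ε < 6·7^T, 2T+3 ≤ k, 3T+4 ≤ l⋆» ⟹ the NEG range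
reaches 6·7^{⌊(k−3)/2⌋}/ε): l₀⁸(k) ≍ 7^{k/2}/ε(k) within the factor [6/7^{3/2}…, 1] — the booked «l₀ exponential in the local height H = 2k» as a theorem for ALL k.
TAKES NO SIDE on [IUTchIII] Cor. 3.12 or on any author; nothing here asserts abc; `HBand`/`StrictMinPow` are row 8's CANDIDATE vocabulary (hypotheses); «in/out of
Σ₈» = the hypothesis's own top cell at the integer data holds/fails. [claim: Mochizuki2012, status: disputed] for the reading; the arithmetic is [folklore].
-/

namespace Summit.ABC.IUTFork.Repair.RHHeightClass.KLine

open Summit.ABC.IUTFork.Repair.RHHeightClass Summit.ABC.IUTFork.Repair.RH.Q3LTailBand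

/-- **The minimiser sits at or below `T` when `e < p^T·(p−1)`**, hence the strict minimum is `≥ −T·e`: `g(t) = p^t − t·e` increases strictly from `T` on
(`pow_sub_lt_of_hi`), so a strict minimiser `t₀ > T` is impossible, and `g(t₀) ≥ −t₀·e ≥ −T·e`. [folklore] -/
theorem strictMinPow_ge_neg_of_lt {p e T : ℕ} {r : ℤ} (hp : 1 ≤ p) (hr : StrictMinPow p e r) (hT : (e : ℤ) < (p : ℤ) ^ T * ((p : ℤ) - 1)) :
    -((T : ℤ) * e) ≤ r := by
  obtain ⟨t₀, ht₀, hmin⟩ := hr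
  have ht₀T : t₀ ≤ T := by
    by_contra h
    obtain ⟨s, rfl⟩ : ∃ s, t₀ = T + s + 1 := ⟨t₀ - T - 1, by omega⟩
    have h1 := pow_sub_lt_of_hi hp hT s          -- g T < g (T+s+1) = r
    have h2 := hmin T (by omega)                  -- r < g T
    rw [ht₀] at h1
    exact absurd (h1.trans h2) (lt_irrefl _)
  have hp0 : (0 : ℤ) ≤ (p : ℤ) ^ t₀ := by positivity
  have he0 : (0 : ℤ) ≤ e := by positivity
  have hle : (t₀ : ℤ) * e ≤ (T : ℤ) * e := mul_le_mul_of_nonneg_right (by exact_mod_cast ht₀T) he0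
  rw [← ht₀]
  linarith

/-- **K-LINE IN-LAW (every k).** `p = 7 < l` prime, `ε ≥ 1`, `0 ≤ k ≤ 2t`, `7^t ≤ l·ε` ⟹ the untied `r♯(7, l·ε)` exists and the row-8 top cell (`m_q = k·ε`,
`l⋆ = l/2`) HOLDS at it: `λ_k ∈ Σ₈` at every prime `l ≥ 7^{⌈k/2⌉}/ε(k)` — l₀⁸(k)·ε(k) ≤ 7^{⌈k/2⌉} up to the next prime (cf. the exact table:
k = 30, ε = 1: l₀ = 7^15 − 24). Wrapper of `hexSlice_of_k_le` with the binders discharged by `strictMinPow_le_one` / `strictMinPow_le_pow_sub`. [folklore] -/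
theorem kline_in_of_pow_le {l ε : ℕ} {k : ℤ} {t : ℕ} (hl : l.Prime) (h11 : 11 ≤ l) (hε : 1 ≤ ε) (hk0 : 0 ≤ k) (hk : k ≤ 2 * t)
    (hpt : 7 ^ t ≤ l * ε) :
    (∃ r : ℤ, StrictMinPow 7 (l * ε) r) ∧
      ∀ r : ℤ, StrictMinPow 7 (l * ε) r →
        ((((l / 2 : ℕ) : ℤ)) ^ 2 - 1) * (k * ε) ≤ ((l / 2 : ℕ) : ℤ) * (((l * ε : ℕ) : ℤ) - r) + (1 - r) := by
  have hodd : l % 2 = 1 := Nat.odd_iff.1 (hl.odd_of_ne_two (by omega))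
  refine ⟨exists_strictMinPow_kline (p := 7) (by norm_num) hl (by omega) ε, fun r hr => ?_⟩
  have hcast : ((l * ε : ℕ) : ℤ) = (2 * ((l / 2 : ℕ) : ℤ) + 1) * ε := by
    have h1 : ((l * ε : ℕ) : ℤ) = (l : ℤ) * ε := by push_cast; ring
    have h2 : (l : ℤ) = 2 * ((l / 2 : ℕ) : ℤ) + 1 := by omega
    rw [h1, h2]
  have hr1 := strictMinPow_le_one hr
  have hrt := strictMinPow_le_pow_sub hr t
  have hpt' : ((7 : ℕ) : ℤ) ^ t ≤ ((l * ε : ℕ) : ℤ) := by exact_mod_cast hpt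
  rw [hcast] at hrt hpt' ⊢
  exact hexSlice_of_k_le (p := 7) (by omega) (by exact_mod_cast hε) hk0 hr1 hrt hpt' (by exact_mod_cast hk)

/-- **K-LINE OUT-LAW (every k).** `p = 7 < l` prime with `l⋆ = l/2 ≥ 3T + 4`, `ε ≥ 1`, `l·ε < 6·7^T` (the minimiser of `t ↦ 7^t − t·lε` is `≤ T`) and
`k ≥ 2T + 3` ⟹ the row-8 top cell FAILS at the untied `r♯(7, l·ε)`: `λ_k ∉ Σ₈` at every such prime — the NEG range of the K-line reaches `l·ε < 6·7^{⌊(k−3)/2⌋}`,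
so with `kline_in_of_pow_le`: `l₀⁸(k)·ε(k) ∈ [6·7^{⌊(k−3)/2⌋}, next prime ≥ 7^{⌈k/2⌉}]`, exponential in the local height `H = 2k` for EVERY k. Wrapper of
`not_hexSlice_of_k_ge` with `strictMinPow_ge_neg_of_lt`. [folklore] -/
theorem kline_out_of_lt {l ε : ℕ} {k : ℤ} {T : ℕ} (hl : l.Prime) (h11 : 11 ≤ l) (hε : 1 ≤ ε) (hls : 3 * T + 4 ≤ l / 2)
    (hlt : l * ε < 6 * 7 ^ T) (hk : 2 * (T : ℤ) + 3 ≤ k) :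
    ∀ r : ℤ, StrictMinPow 7 (l * ε) r →
      ¬ ((((l / 2 : ℕ) : ℤ)) ^ 2 - 1) * (k * ε) ≤ ((l / 2 : ℕ) : ℤ) * (((l * ε : ℕ) : ℤ) - r) + (1 - r) := by
  intro r hr
  have hodd : l % 2 = 1 := Nat.odd_iff.1 (hl.odd_of_ne_two (by omega))
  have hcast : ((l * ε : ℕ) : ℤ) = (2 * ((l / 2 : ℕ) : ℤ) + 1) * ε := by
    have h1 : ((l * ε : ℕ) : ℤ) = (l : ℤ) * ε := by push_cast; ring
    have h2 : (l : ℤ) = 2 * ((l / 2 : ℕ) : ℤ) + 1 := by omega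
    rw [h1, h2]
  have hT : ((l * ε : ℕ) : ℤ) < (7 : ℤ) ^ T * ((7 : ℤ) - 1) := by
    have : ((l * ε : ℕ) : ℤ) < ((6 * 7 ^ T : ℕ) : ℤ) := by exact_mod_cast hlt
    push_cast at this ⊢
    linarith
  have hrT := strictMinPow_ge_neg_of_lt (p := 7) (by norm_num) hr (by exact_mod_cast hT)
  rw [hcast] at hrT ⊢
  exact not_hexSlice_of_k_ge (T := (T : ℤ)) (by exact_mod_cast hε) (by positivity) hrT (by exact_mod_cast hls) hk

/-- **Worked instance of the law (no table):** `k = 9` (`ε = 10`): IN at every prime `l ≥ 1681` (`7^5 = 16807 ≤ 10·l`, `9 ≤ 2·5`) — the exact value is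
l₀⁸(9) = 461 (`lambda9_sigma8_iff`), inside the law's bracket `[6·7^3/10, 7^5/10] = [205.8, 1680.7]`. [folklore] -/
theorem kline9_in_of_ge_1681 {l : ℕ} (hl : l.Prime) (h : 1681 ≤ l) :
    (∃ r : ℤ, StrictMinPow 7 (l * 10) r) ∧
      ∀ r : ℤ, StrictMinPow 7 (l * 10) r →
        ((((l / 2 : ℕ) : ℤ)) ^ 2 - 1) * ((9 : ℤ) * 10) ≤ ((l / 2 : ℕ) : ℤ) * (((l * 10 : ℕ) : ℤ) - r) + (1 - r) :=
  kline_in_of_pow_le (t := 5) hl (by omega) (by norm_num) (by norm_num) (by norm_num) (by omega)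

/-- **Worked instance, OUT side:** `k = 9` (`ε = 10`), `T = 3`: OUT at every prime `l` with `13 ≤ l/2` and `10·l < 6·343 = 2058`, i.e. `29 ≤ l ≤ 199`
(exact NEG range: `11 ≤ l ≤ 457`). [folklore] -/
theorem kline9_out_of_le_199 {l : ℕ} (hl : l.Prime) (h29 : 29 ≤ l) (h199 : l ≤ 199) :
    ∀ r : ℤ, StrictMinPow 7 (l * 10) r →
      ¬ ((((l / 2 : ℕ) : ℤ)) ^ 2 - 1) * ((9 : ℤ) * 10) ≤ ((l / 2 : ℕ) : ℤ) * (((l * 10 : ℕ) : ℤ) - r) + (1 - r) :=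
  kline_out_of_lt (T := 3) hl (by omega) (by norm_num) (by omega) (by omega) (by norm_num)

end Summit.ABC.IUTFork.Repair.RHHeightClass.KLine
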